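import Summits.BirchSwinnertonDyer.BirchSwinnertonDyer.Theorems.ErratumRoadFiveIMCDivCongruenceCoefficientDescentLe
import HarnessLib

/-!
# Route `UniversalToricDescent`, cruxes `TwinSplitIMCAtThreeMult` (20694) / ♭B `TwinWanFrameAtThreeMult` (26062),
# line `membertower`: the Road-FF one-sided congruence descent and recombination WITH A UNIFORM `p^e` TWIST
# (RATIONAL member inclusions `p^e·Ch(X^Σ_ac(A_{g_m}))·S' ⊆ (L_m)`, `e` independent of `m`)

Cell `bsd-wall` (run/shared/lean/pub/bsd-wall/), seat `bsd-wall-utd-p2` (lead prover g11, 2026-08-28);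
`--supports stmt-BirchSwinnertonDyer-20694 --as helper`; Theses-free, pure algebra on the tree objects.

## Why

The act-D crux ♭B tolerates a fixed power of `3`: `∃ k, 3^k·Ch_Λ(X_ac(W′))·R₀⟦T⟧ ⊆ (L)`. The Eisenstein engine the member-tower
line relies on (Yan–Zhu 2026 / [SU14] under an ALL-SPLIT `K`) yields, per Hida member `g_m`, an inclusion that is a priori
only RATIONAL — after inverting a multiplicative set `S ⊂ Λ_K⁺` ([YZ] Cor. 4.6), i.e. `p^{e}·Ch ⊆ (L_m)` — and the
line's point (card member-tower-fitting-limit, K1b) is that the exponent `e` can be taken UNIFORM in `m`. The tree's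
descent (`CongruenceDescent.map_le_span_of_oneSided_congruences_descent_le`, cell bsd-stepL) and recombination
(`AcSelmer.XAc.charIdeal_map_toUnr_le_span_of_map_fittingIdeal_le`) are INTEGRAL (`e = 0`). This file threads an
arbitrary element `a ∈ R` (resp. `a = C(p)^e ∈ Λ`) through both:

* §1 `CongruenceDescent.map_span_mul_fittingIdeal_le_sup_of_congruence_descent_le` — one congruence step with the member
  inclusion twisted: `(a·Fitt_{R'}(N))·S' ⊆ (L_m)` ⟹ `(a·Fitt_R(M))·S ⊆ (L) + I^m S`;
  `CongruenceDescent.map_le_span_of_oneSided_congruences_descent_le_of_le_span_mul` — Krull: `J ⊆ a·Fitt_R(M)` ⟹ `J·S ⊆ (L)`.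
* §2 on `X^Σ = X_ac^Σ(E[p^∞])`: `AcSelmer.XAc.map_span_mul_fittingIdeal_le_span_of_oneSided_congruences_descent_le_printed`
  (members in the PRINTED shape «`N_m` torsion → `(a·Ch(N_m))·S'_m ⊆ (L_m)`») ⟹ `(a·Fitt₀(X^Σ))·R₀⟦T⟧ ⊆ (L^Σ)`; and the
  twisted recombination `AcSelmer.XAc.forall_C_pow_mul_mem_span_of_map_span_mul_fittingIdeal_le`: with `a = C(p)^e`, the
  `Σ`-data and `L·φ(P_Σ) ∣ L^Σ` ⟹ `∀ G ∈ Ch_Λ(X^∅)·R₀⟦T⟧, C(p^e)·G ∈ (L)` — EXACTLY the `∃ k`-clause of ♭B with `k = e`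
  (torsion bounds `(p)^a·Ch, (T)^b·Ch ⊆ Fitt₀`, cancellation of `φ(P_Σ)`, two-prime lemma applied to `y = C(p^e)·φ(G)`).

HONEST FRAMING: theorems only (no definition, no named fact, no instance, no `sorry`); unconditional algebra; nothing is
booked; BSD is proved for no curve. Consumer: `UniversalToricDescentRoadFFDescentOddRational` (same seat).

References: [Skinner2016PacificMC] §2.6, §3.1 (p. 192); [Castella2018Erratum] (b), (c), Lemma 2.1, (2.5), proof of Thm. 1.1 (p. 4);
[YanZhu2026] Cor. 4.6, §4.3 (the `S⁻¹`-inclusion and the removal of `S`; arXiv:2412.20078 pp. 10–11); [StacksProject] 07ZA (3), 05GI.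
-/

set_option autoImplicit false

noncomputable section

open scoped Classical TensorProduct

open PowerSeries Literature.NumberTheory.EllipticCurves Literature.NumberTheory.EllipticCurves.Module
  Literature.RingTheory.FittingIdeal NumberField IsDedekindDomain Field
open Summit.BirchSwinnertonDyer.Rank1Residual.X11b.AcSelmer Summit.BirchSwinnertonDyer.Rank1Residual.X11b.Halves
  Summit.BirchSwinnertonDyer.Rank1Residual.X2
open Summit.BirchSwinnertonDyer.BirchSwinnertonDyer.Theorems (exists_span_C_pow_mul_span_le_fittingIdeal_zero)

namespace Summit.BirchSwinnertonDyer.Rank1Residual.X11b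

/-! ### §1 The one-sided congruence step and limit, twisted by an element `a ∈ R` -/

namespace CongruenceDescent

universe u v w

variable {R : Type*} [CommRing R] {S : Type u} [CommRing S] (φ : R →+* S) (I : Ideal R)
  {M : Type*} [AddCommGroup M] [Module R M] [Module.Finite R M]

/-- **One congruence step with its own coefficients, (c) ONE-SIDED, member inclusion TWISTED by `a ∈ R`.** Data as in
`map_fittingIdeal_le_sup_of_congruence_descent_le` (square `R → R' →(φ') S' ← S`, `S'` faithfully flat over `S`,
`(R' ⊗_R M)/I^m ≅ N/I^m`, `(L_m) ⊆ (L) + I^m S'`) except that the member inclusion reads `(a·Fitt_{R'}(N))·S' ⊆ (L_m)`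
(`a` read in `R'`). Then `(a·Fitt_R(M))·S ⊆ (L) + I^m S`. Same proof (Stacks 07ZA (3), Fitting ideals modulo `I^m`,
faithfully flat contraction), the factor `(a)` riding along. [cite: StacksProject, Tag 07ZA (3)]
[cite: Castella2018Erratum, proof of Thm. 1.1 (p. 4), read one-sidedly] -/
theorem map_span_mul_fittingIdeal_le_sup_of_congruence_descent_le (a : R)
    (R' : Type v) [CommRing R'] [Algebra R R'] (S' : Type w) [CommRing S'] [Algebra S S']
    [Module.FaithfullyFlat S S'] (φ' : R' →+* S')
    (hφ' : φ'.comp (algebraMap R R') = (algebraMap S S').comp φ)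
    (N : Type*) [AddCommGroup N] [Module R' N] [Module.Finite R' N] {L : S} {Lm : S'} {m : ℕ}
    (e : ((R' ⊗[R] M) ⧸ ((I.map (algebraMap R R')) ^ m • (⊤ : Submodule R' (R' ⊗[R] M)))) ≃ₗ[R']
      (N ⧸ ((I.map (algebraMap R R')) ^ m • (⊤ : Submodule R' N))))
    (hF : (Ideal.span {algebraMap R R' a} * Module.fittingIdeal R' N 0).map φ' ≤ Ideal.span {Lm})
    (hc : Ideal.span {Lm} ≤
      Ideal.span {algebraMap S S' L} ⊔ ((I.map φ).map (algebraMap S S')) ^ m) :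
    (Ideal.span {a} * Module.fittingIdeal R M 0).map φ ≤ Ideal.span {L} ⊔ (I.map φ) ^ m := by
  set ψ : S →+* S' := algebraMap S S' with hψ
  have hcomp : ψ.comp φ = φ'.comp (algebraMap R R') := by rw [hψ, hφ']
  -- the twisting ideal read in `R'`
  have ha : (Ideal.span {a}).map (algebraMap R R') = Ideal.span {algebraMap R R' a} := by
    rw [Ideal.map_span, Set.image_singleton]
  -- images in `S'` of the ideals involved
  have hA : ((Ideal.span {a} * Module.fittingIdeal R M 0).map φ).map ψ =
      (Ideal.span {algebraMap R R' a} * Module.fittingIdeal R' (R' ⊗[R] M) 0).map φ' := by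
    rw [Ideal.map_map, hcomp, ← Ideal.map_map, Ideal.map_mul, ha, Module.fittingIdeal_baseChange]
  have hB : ((I.map φ) ^ m).map ψ = ((I.map (algebraMap R R')) ^ m).map φ' := by
    rw [Ideal.map_pow, Ideal.map_pow, Ideal.map_map, Ideal.map_map, hcomp]
  have hB' : ((I.map φ).map ψ) ^ m = ((I.map (algebraMap R R')) ^ m).map φ' := by
    rw [← Ideal.map_pow, hB]
  have hC : (Ideal.span {L}).map ψ = Ideal.span {ψ L} := by
    rw [Ideal.map_span, Set.image_singleton]
  -- the twisted one-sided congruence step over `R'`, pushed to `S'`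
  have hstep : (Ideal.span {algebraMap R R' a} * Module.fittingIdeal R' (R' ⊗[R] M) 0).map φ' ≤
      Ideal.span {Lm} ⊔ ((I.map (algebraMap R R')) ^ m).map φ' := by
    have h0 : Module.fittingIdeal R' (R' ⊗[R] M) 0 ≤
        Module.fittingIdeal R' N 0 ⊔ (I.map (algebraMap R R')) ^ m := by
      have := (le_sup_left : Module.fittingIdeal R' (R' ⊗[R] M) 0 ≤
        Module.fittingIdeal R' (R' ⊗[R] M) 0 ⊔ (I.map (algebraMap R R')) ^ m)
      rwa [CongruenceLimit.fittingIdeal_sup_eq_of_quotEquiv ((I.map (algebraMap R R')) ^ m) e 0] at this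
    have h1 : Ideal.span {algebraMap R R' a} * Module.fittingIdeal R' (R' ⊗[R] M) 0 ≤
        Ideal.span {algebraMap R R' a} * Module.fittingIdeal R' N 0 ⊔ (I.map (algebraMap R R')) ^ m :=
      (Ideal.mul_mono_right h0).trans (by
        rw [Ideal.mul_sup]
        exact sup_le_sup_left Ideal.mul_le_left _)
    refine (Ideal.map_mono h1).trans ?_
    rw [Ideal.map_sup]
    exact sup_le_sup_right hF _
  -- hence the inclusion of the images in `S'`
  have himg : ((Ideal.span {a} * Module.fittingIdeal R M 0).map φ).map ψ ≤
      (Ideal.span {L} ⊔ (I.map φ) ^ m).map ψ := by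
    rw [Ideal.map_sup, hA, hB, hC]
    refine hstep.trans (sup_le ?_ le_sup_right)
    rw [← hB']
    exact hc
  -- contract to `S` (faithful flatness)
  have h := Ideal.comap_mono (f := ψ) himg
  rwa [hψ, Ideal.comap_map_eq_self_of_faithfullyFlat,
    Ideal.comap_map_eq_self_of_faithfullyFlat] at h

/-- **The one-sided congruence limit, per-member coefficients, (c) one-sided, TWISTED by `a ∈ R`** — `S` Noetherian with
`φ(I) ⊆ Jac(S)`; `J ⊆ a·Fitt_R(M)`; for every `m ≥ 1` a coefficient square with `S'_m` faithfully flat, a finite `R'_m`-module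
`N_m`, `(R'_m ⊗_R M)/I^m ≅ N_m/I^m`, the TWISTED member inclusion `(a·Fitt_{R'_m}(N_m))·S'_m ⊆ (L_m)` and `(L_m) ⊆ (L) + I^m S'_m`.
Then `J·S ⊆ ⋂_m ((L) + I^m S) = (L)` (Krull). The case `a = 1` is `map_le_span_of_oneSided_congruences_descent_le`.
[cite: Skinner2016PacificMC, §3.1 (p. 192)] [cite: StacksProject, Tag 05GI (Krull's intersection theorem)] -/
theorem map_le_span_of_oneSided_congruences_descent_le_of_le_span_mul [IsNoetherianRing S]
    (hI : I.map φ ≤ (⊥ : Ideal S).jacobson) (a : R) {J : Ideal R}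
    (hJ : J ≤ Ideal.span {a} * Module.fittingIdeal R M 0)
    (L : S) (R' : ℕ → Type v) [∀ m, CommRing (R' m)] [∀ m, Algebra R (R' m)]
    (S' : ℕ → Type w) [∀ m, CommRing (S' m)] [∀ m, Algebra S (S' m)]
    [∀ m, Module.FaithfullyFlat S (S' m)] (φ' : ∀ m, R' m →+* S' m)
    (hφ' : ∀ m, (φ' m).comp (algebraMap R (R' m)) = (algebraMap S (S' m)).comp φ)
    (N : ℕ → Type*) [∀ m, AddCommGroup (N m)] [∀ m, Module (R' m) (N m)]
    [∀ m, Module.Finite (R' m) (N m)] (Lm : ∀ m, S' m)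
    (e : ∀ m : ℕ, 1 ≤ m →
      (((R' m ⊗[R] M) ⧸ ((I.map (algebraMap R (R' m))) ^ m •
          (⊤ : Submodule (R' m) (R' m ⊗[R] M)))) ≃ₗ[R' m]
        (N m ⧸ ((I.map (algebraMap R (R' m))) ^ m • (⊤ : Submodule (R' m) (N m))))))
    (hF : ∀ m : ℕ, 1 ≤ m →
      (Ideal.span {algebraMap R (R' m) a} * Module.fittingIdeal (R' m) (N m) 0).map (φ' m) ≤
        Ideal.span {Lm m})
    (hc : ∀ m : ℕ, 1 ≤ m →
      Ideal.span {Lm m} ≤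
        Ideal.span {algebraMap S (S' m) L} ⊔ ((I.map φ).map (algebraMap S (S' m))) ^ m) :
    J.map φ ≤ Ideal.span {L} := by
  refine (Ideal.map_mono hJ).trans ?_
  rw [← CongruenceLimit.iInf_sup_pow_eq_self (I.map φ) (Ideal.span {L}) hI]
  refine le_iInf fun m ↦ ?_
  rcases Nat.eq_zero_or_pos m with rfl | hm
  · rw [pow_zero, Ideal.one_eq_top, sup_top_eq]; exact le_top
  · exact le_sup_left.trans (sup_le
      (map_span_mul_fittingIdeal_le_sup_of_congruence_descent_le φ I a (R' m) (S' m) (φ' m) (hφ' m) (N m)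
        (e m hm) (hF m hm) (hc m hm)) le_sup_right)

/-- **PRINTED-shape conversion, twisted**: over a Noetherian UFD `R'`, «`N` torsion → `(a'·Ch(N))·S' ⊆ (L')`» gives
«`(a'·Fitt₀(N))·S' ⊆ (L')`» (`Fitt₀ ⊆ Ch` for torsion modules, `Fitt₀ = 0` otherwise). [cite: StacksProject, Tag 07ZA] -/
theorem map_span_mul_fittingIdeal_le_of_printed_charIdeal_le {R' : Type v} [CommRing R'] [IsNoetherianRing R']
    [IsDomain R'] [UniqueFactorizationMonoid R'] {S' : Type w} [CommRing S'] (φ' : R' →+* S') (a' : R')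
    {N : Type} [AddCommGroup N] [Module R' N] [Module.Finite R' N] {L' : S'}
    (hCh : Module.IsTorsion R' N → (Ideal.span {a'} * Module.charIdeal R' N).map φ' ≤ Ideal.span {L'}) :
    (Ideal.span {a'} * Module.fittingIdeal R' N 0).map φ' ≤ Ideal.span {L'} := by
  by_cases hNt : Module.IsTorsion R' N
  · exact (Ideal.map_mono (Ideal.mul_mono_right (CongruenceLimit.fittingIdeal_zero_le_charIdeal hNt))).trans
      (hCh hNt)
  · have h0 : Module.fittingIdeal R' N 0 = ⊥ :=
      le_bot_iff.mp (Module.fittingIdeal_zero_le_annihilator.trans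
        (Module.annihilator_eq_bot_of_not_isTorsion hNt).le)
    rw [h0, Ideal.mul_bot, Ideal.map_bot]
    exact bot_le

end CongruenceDescent

/-! ### §2 On `X^Σ = X_ac^Σ(E[p^∞])`: the twisted Fitting-level member limit and the twisted recombination -/

section XAc

variable {K : Type} [Field K] [NumberField K] (E : WeierstrassCurve K) [E.IsElliptic]
  (p : ℕ) [Fact p.Prime] (κ : ZpExtension K p) (𝔭 : HeightOneSpectrum (𝓞 K))
  {S : Set (HeightOneSpectrum (𝓞 K))} (γ : Field.absoluteGaloisGroup K) [Fact (κ.IsTopGenerator γ)]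

universe v w

/-- **The member limit ON `X^Σ` at the Fitting level, members in the PRINTED shape, TWISTED by `a ∈ Λ`**: `Σ` finite;
coefficient squares `Λ → R'_m →(φ'_m) S'_m ← R₀⟦T⟧` over Noetherian UFDs `R'_m` with `S'_m` faithfully flat; finite
`R'_m`-modules `N_m` with `(R'_m ⊗_Λ X^Σ)/p^m ≅ N_m/p^m`; the RATIONAL member inclusions «`N_m` torsion →
`(a·Ch_{R'_m}(N_m))·S'_m ⊆ (L_m)`» with ONE `a` for all `m`; `(L_m) ⊆ (L^Σ) + (p^m)`. THEN `(a·Fitt₀_Λ(X^Σ))·R₀⟦T⟧ ⊆ (L^Σ)`.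
The case `a = 1` is `…_descent_le_printed` (cell bsd-stepL). Pure algebra; CONDITIONAL on the displayed inputs.
[cite: Castella2018Erratum, (2.5) and proof of Thm. 1.1 (p. 4), read one-sidedly] [cite: Skinner2016PacificMC, §2.6, §3.1 (p. 192)] -/
theorem AcSelmer.XAc.map_span_mul_fittingIdeal_le_span_of_oneSided_congruences_descent_le_printed
    (hS : S.Finite) (a : IwasawaAlgebra p) (LS : UnrSeries p) (R' : ℕ → Type v) [∀ m, CommRing (R' m)]
    [∀ m, IsNoetherianRing (R' m)] [∀ m, IsDomain (R' m)] [∀ m, UniqueFactorizationMonoid (R' m)]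
    [∀ m, Algebra (IwasawaAlgebra p) (R' m)]
    (S' : ℕ → Type w) [∀ m, CommRing (S' m)] [∀ m, Algebra (UnrSeries p) (S' m)]
    [∀ m, Module.FaithfullyFlat (UnrSeries p) (S' m)] (φ' : ∀ m, R' m →+* S' m)
    (hφ' : ∀ m, (φ' m).comp (algebraMap (IwasawaAlgebra p) (R' m)) =
      (algebraMap (UnrSeries p) (S' m)).comp (PowerSeries.map (toUnr p)))
    (N : ℕ → Type) [∀ m, AddCommGroup (N m)] [∀ m, Module (R' m) (N m)]
    [∀ m, Module.Finite (R' m) (N m)] (Lm : ∀ m, S' m)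
    (e : ∀ m : ℕ, 1 ≤ m →
      (((R' m ⊗[IwasawaAlgebra p] XAc E p κ 𝔭 S γ) ⧸
          (((Ideal.span {(PowerSeries.C (p : ℤ_[p]) : IwasawaAlgebra p)}).map
              (algebraMap (IwasawaAlgebra p) (R' m))) ^ m •
            (⊤ : Submodule (R' m) (R' m ⊗[IwasawaAlgebra p] XAc E p κ 𝔭 S γ)))) ≃ₗ[R' m]
        (N m ⧸ (((Ideal.span {(PowerSeries.C (p : ℤ_[p]) : IwasawaAlgebra p)}).map
            (algebraMap (IwasawaAlgebra p) (R' m))) ^ m • (⊤ : Submodule (R' m) (N m))))))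
    (hCh : ∀ m : ℕ, 1 ≤ m → Module.IsTorsion (R' m) (N m) →
      (Ideal.span {algebraMap (IwasawaAlgebra p) (R' m) a} * Module.charIdeal (R' m) (N m)).map (φ' m) ≤
        Ideal.span {Lm m})
    (hc : ∀ m : ℕ, 1 ≤ m →
      Ideal.span {Lm m} ≤
        Ideal.span {algebraMap (UnrSeries p) (S' m) LS} ⊔
          (((Ideal.span {(PowerSeries.C (p : ℤ_[p]) : IwasawaAlgebra p)}).map
              (PowerSeries.map (toUnr p))).map (algebraMap (UnrSeries p) (S' m))) ^ m) :
    (Ideal.span {a} * Module.fittingIdeal (IwasawaAlgebra p) (XAc E p κ 𝔭 S γ) 0).map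
        (PowerSeries.map (toUnr p)) ≤ Ideal.span {LS} := by
  haveI : Module.Finite (IwasawaAlgebra p) (XAc E p κ 𝔭 S γ) := XAc.module_finite κ 𝔭 S γ hS
  haveI := HidaLimitAlgebra.isNoetherianRing_unrSeries (p := p)
  have hI : (Ideal.span {(PowerSeries.C (p : ℤ_[p]) : IwasawaAlgebra p)}).map
      (PowerSeries.map (toUnr p)) ≤ (⊥ : Ideal (UnrSeries p)).jacobson := by
    rw [HidaLimitAlgebra.map_span_C_p]
    exact HidaLimitAlgebra.span_C_p_le_jacobson_unrSeries
  exact CongruenceDescent.map_le_span_of_oneSided_congruences_descent_le_of_le_span_mul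
    (PowerSeries.map (toUnr p)) (Ideal.span {(PowerSeries.C (p : ℤ_[p]) : IwasawaAlgebra p)}) hI a
    (le_refl _) LS R' S' φ' hφ' N Lm e
    (fun m hm ↦ CongruenceDescent.map_span_mul_fittingIdeal_le_of_printed_charIdeal_le (φ' m)
      (algebraMap (IwasawaAlgebra p) (R' m) a) (hCh m hm)) hc

set_option maxHeartbeats 400000 in
/-- **TWISTED RECOMBINATION — from `(p^e·Fitt₀(X^Σ))·R₀⟦T⟧ ⊆ (L^Σ)` to the `∃ k`-clause of ♭B with `k = e`.** `Σ` finite,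
`X^Σ` torsion, `P_Σ ≠ 0`, `Ch(X^∅)·(P_Σ) ⊆ Ch(X^Σ)`, `L·φ(P_Σ) ∣ L^Σ` (the `Σ`-data and the frame's (3.1)), and the twisted key
with `a = C(p)^e`: then every `G ∈ Ch_Λ(X^∅)·R₀⟦T⟧` has `C(p^e)·G ∈ (L)`. Proof = imc24b's
`charIdeal_map_toUnr_le_span_of_map_fittingIdeal_le` with the factor riding along: torsion bounds `(p)^a·Ch(X^Σ) ⊆ Fitt₀`,
`(T)^b·Ch(X^Σ) ⊆ Fitt₀`; so `L^Σ ∣ p̄^e p̄^a F` and `L^Σ ∣ p̄^e T^b F`; cancel `φ(P_Σ)`; the two-prime lemma applied to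
`y = p̄^e·φ(G)`. [cite: Castella2018Erratum, proof of Thm. 1.1 (p. 4), read one-sidedly] -/
theorem AcSelmer.XAc.forall_C_pow_mul_mem_span_of_map_span_mul_fittingIdeal_le (hS : S.Finite)
    (hT : Module.IsTorsion (IwasawaAlgebra p) (XAc E p κ 𝔭 S γ)) (e : ℕ) {LS : UnrSeries p}
    (key : (Ideal.span {(PowerSeries.C (p : ℤ_[p]) : IwasawaAlgebra p) ^ e} *
        Module.fittingIdeal (IwasawaAlgebra p) (XAc E p κ 𝔭 S γ) 0).map (PowerSeries.map (toUnr p)) ≤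
      Ideal.span {LS})
    {PS : IwasawaAlgebra p} (hPS : PS ≠ 0)
    (hX : XAc.charIdeal E p κ 𝔭 ∅ γ * Ideal.span {PS} ≤ XAc.charIdeal E p κ 𝔭 S γ)
    {L : UnrSeries p} (hLS : L * PowerSeries.map (toUnr p) PS ∣ LS) :
    ∀ G ∈ (XAc.charIdeal E p κ 𝔭 ∅ γ).map (PowerSeries.map (toUnr p)),
      PowerSeries.C (((p : ℕ) : unrIntegers p) ^ e) * G ∈ Ideal.span {L} := by
  set φ : IwasawaAlgebra p →+* UnrSeries p := PowerSeries.map (toUnr p) with hφ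
  haveI : Module.Finite (IwasawaAlgebra p) (XAc E p κ 𝔭 S γ) := XAc.module_finite κ 𝔭 S γ hS
  haveI := HidaLimitAlgebra.isNoetherianRing_unrSeries (p := p)
  haveI := HidaLimitAlgebra.isDiscreteValuationRing_unrIntegers (p := p)
  obtain ⟨F, hFS⟩ := (charIdeal_isPrincipal_holds p (XAc E p κ 𝔭 S γ)).principal
  obtain ⟨G₀, hG0⟩ := (charIdeal_isPrincipal_holds p (XAc E p κ 𝔭 ∅ γ)).principal
  have hFS1 : Module.charIdeal (IwasawaAlgebra p) (XAc E p κ 𝔭 S γ) = Ideal.span {F} := hFS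
  have hG1 : XAc.charIdeal E p κ 𝔭 ∅ γ = Ideal.span {G₀} := hG0
  have hFS2 : XAc.charIdeal E p κ 𝔭 S γ = Ideal.span {F} := hFS
  obtain ⟨a, ha⟩ := exists_span_C_pow_mul_span_le_fittingIdeal_zero (XAc E p κ 𝔭 S γ) hT hFS1
  obtain ⟨b, hb⟩ :=
    CongruenceDescent.exists_span_X_pow_mul_span_le_fittingIdeal_zero (XAc E p κ 𝔭 S γ) hT hFS1
  -- the twisting element and its image `p̄^e`
  set t : IwasawaAlgebra p := (PowerSeries.C (p : ℤ_[p]) : IwasawaAlgebra p) ^ e with ht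
  have hφt : φ t = PowerSeries.C (((p : ℕ) : unrIntegers p) ^ e) := by
    rw [ht, map_pow, hφ, PowerSeries.map_C, map_natCast, map_pow]
  have memS : ∀ {x : IwasawaAlgebra p} {n : ℕ},
      Ideal.span {x} ^ n * Ideal.span {F} ≤
        Module.fittingIdeal (IwasawaAlgebra p) (XAc E p κ 𝔭 S γ) 0 → LS ∣ φ t * (φ x ^ n * φ F) := by
    intro x n hle
    have hmem : x ^ n * F ∈ Ideal.span {x} ^ n * Ideal.span {F} := by
      rw [Ideal.span_singleton_pow]
      exact Ideal.mul_mem_mul (Ideal.mem_span_singleton_self _) (Ideal.mem_span_singleton_self _)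
    have hmem' : t * (x ^ n * F) ∈ Ideal.span {t} * Module.fittingIdeal (IwasawaAlgebra p) (XAc E p κ 𝔭 S γ) 0 :=
      Ideal.mul_mem_mul (Ideal.mem_span_singleton_self _) (hle hmem)
    have h := key (Ideal.mem_map_of_mem φ hmem')
    rw [map_mul φ t, map_mul φ (x ^ n), map_pow φ x n] at h
    exact Ideal.mem_span_singleton.mp h
  have hpa : LS ∣ φ t * ((C ((p : ℕ) : unrIntegers p) : UnrSeries p) ^ a * φ F) := by
    have h := memS ha
    rwa [show φ (PowerSeries.C (p : ℤ_[p])) = (C ((p : ℕ) : unrIntegers p) : UnrSeries p) by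
      rw [hφ, PowerSeries.map_C, map_natCast]] at h
  have hTb : LS ∣ φ t * ((X : UnrSeries p) ^ b * φ F) := by
    have h := memS hb
    rwa [show φ (X : IwasawaAlgebra p) = (X : UnrSeries p) by rw [hφ, PowerSeries.map_X]] at h
  have hFG : φ F ∣ φ G₀ * φ PS := by
    rw [← map_mul]
    refine map_dvd φ (Ideal.mem_span_singleton.mp ?_)
    rw [← hFS2]
    refine hX ?_
    rw [hG1]
    exact Ideal.mul_mem_mul (Ideal.mem_span_singleton_self G₀) (Ideal.mem_span_singleton_self PS)
  have hPS' : φ PS ≠ 0 := fun h ↦ hPS (map_toUnr_injective (by rw [← hφ, h, map_zero]))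
  -- cancel `φ(P_Σ)`: from `LS ∣ z·φF` get `L ∣ z·φG₀`
  have cancel : ∀ {z : UnrSeries p}, LS ∣ z * φ F → L ∣ z * φ G₀ := by
    intro z hz
    have h : L * φ PS ∣ z * φ G₀ * φ PS :=
      calc L * φ PS ∣ LS := hLS
        _ ∣ z * φ F := hz
        _ ∣ z * (φ G₀ * φ PS) := mul_dvd_mul_left z hFG
        _ = z * φ G₀ * φ PS := (mul_assoc _ _ _).symm
    exact (mul_dvd_mul_iff_right hPS').mp h
  -- the two divisibilities of `y = p̄^e·φ(G₀)`
  have hL1 : L ∣ (C ((p : ℕ) : unrIntegers p) : UnrSeries p) ^ a * (φ t * φ G₀) := by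
    have h := cancel (z := φ t * (C ((p : ℕ) : unrIntegers p) : UnrSeries p) ^ a)
      (by simpa only [mul_assoc] using hpa)
    simpa only [mul_assoc, mul_comm, mul_left_comm] using h
  have hL2 : L ∣ (X : UnrSeries p) ^ b * (φ t * φ G₀) := by
    have h := cancel (z := φ t * (X : UnrSeries p) ^ b) (by simpa only [mul_assoc] using hTb)
    simpa only [mul_assoc, mul_comm, mul_left_comm] using h
  have hLG : L ∣ φ t * φ G₀ :=
    CongruenceDescent.dvd_of_dvd_prime_pow_mul_of_dvd_prime_pow_mul
      (prime_C_of_prime CongruenceDescent.prime_natCast_p_unrIntegers)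
      CongruenceDescent.not_C_p_dvd_X_unrSeries a b L (φ t * φ G₀) hL1 hL2
  -- conclude for every element of `Ch(X^∅)·R₀⟦T⟧ = (φ G₀)`
  intro G hG
  rw [hG1, Ideal.map_span, Set.image_singleton] at hG
  obtain ⟨r, rfl⟩ := Ideal.mem_span_singleton'.mp hG
  rw [← hφt]
  have : φ t * (r * φ G₀) = r * (φ t * φ G₀) := by ring
  rw [this]
  exact Ideal.mul_mem_left _ r (Ideal.mem_span_singleton.mpr hLG)

/-- **The same twisted member limit with the twist ALREADY MAPPED into the receptacle** (consumer-friendly spelling: the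
member inclusion reads «torsion → `(φ'_m(a)·Ch(N_m)·S'_m) ⊆ (L_m)`» with the element `φ'_m(a_{R'_m})` of `S'_m`, so that a
consumer whose receptacles are large concrete rings does not have to rewrite `Ideal.map` of a product there). Immediate from
the previous theorem (`Ideal.map_mul`, `Ideal.map_span`). [cite: Castella2018Erratum, (2.5) and proof of Thm. 1.1 (p. 4), read one-sidedly] -/
theorem AcSelmer.XAc.map_span_mul_fittingIdeal_le_span_of_oneSided_congruences_descent_le_printed'
    (hS : S.Finite) (a : IwasawaAlgebra p) (LS : UnrSeries p) (R' : ℕ → Type v) [∀ m, CommRing (R' m)]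
    [∀ m, IsNoetherianRing (R' m)] [∀ m, IsDomain (R' m)] [∀ m, UniqueFactorizationMonoid (R' m)]
    [∀ m, Algebra (IwasawaAlgebra p) (R' m)]
    (S' : ℕ → Type w) [∀ m, CommRing (S' m)] [∀ m, Algebra (UnrSeries p) (S' m)]
    [∀ m, Module.FaithfullyFlat (UnrSeries p) (S' m)] (φ' : ∀ m, R' m →+* S' m)
    (hφ' : ∀ m, (φ' m).comp (algebraMap (IwasawaAlgebra p) (R' m)) =
      (algebraMap (UnrSeries p) (S' m)).comp (PowerSeries.map (toUnr p)))
    (N : ℕ → Type) [∀ m, AddCommGroup (N m)] [∀ m, Module (R' m) (N m)]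
    [∀ m, Module.Finite (R' m) (N m)] (Lm : ∀ m, S' m)
    (e : ∀ m : ℕ, 1 ≤ m →
      (((R' m ⊗[IwasawaAlgebra p] XAc E p κ 𝔭 S γ) ⧸
          (((Ideal.span {(PowerSeries.C (p : ℤ_[p]) : IwasawaAlgebra p)}).map
              (algebraMap (IwasawaAlgebra p) (R' m))) ^ m •
            (⊤ : Submodule (R' m) (R' m ⊗[IwasawaAlgebra p] XAc E p κ 𝔭 S γ)))) ≃ₗ[R' m]
        (N m ⧸ (((Ideal.span {(PowerSeries.C (p : ℤ_[p]) : IwasawaAlgebra p)}).map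
            (algebraMap (IwasawaAlgebra p) (R' m))) ^ m • (⊤ : Submodule (R' m) (N m))))))
    (hCh : ∀ m : ℕ, 1 ≤ m → Module.IsTorsion (R' m) (N m) →
      Ideal.span {φ' m (algebraMap (IwasawaAlgebra p) (R' m) a)} * (Module.charIdeal (R' m) (N m)).map (φ' m) ≤
        Ideal.span {Lm m})
    (hc : ∀ m : ℕ, 1 ≤ m →
      Ideal.span {Lm m} ≤
        Ideal.span {algebraMap (UnrSeries p) (S' m) LS} ⊔
          (((Ideal.span {(PowerSeries.C (p : ℤ_[p]) : IwasawaAlgebra p)}).map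
              (PowerSeries.map (toUnr p))).map (algebraMap (UnrSeries p) (S' m))) ^ m) :
    (Ideal.span {a} * Module.fittingIdeal (IwasawaAlgebra p) (XAc E p κ 𝔭 S γ) 0).map
        (PowerSeries.map (toUnr p)) ≤ Ideal.span {LS} :=
  AcSelmer.XAc.map_span_mul_fittingIdeal_le_span_of_oneSided_congruences_descent_le_printed E p κ 𝔭 γ hS a LS R'
    S' φ' hφ' N Lm e
    (fun m hm hT ↦ by
      rw [Ideal.map_mul, Ideal.map_span, Set.image_singleton]
      exact hCh m hm hT) hc

end XAc

end Summit.BirchSwinnertonDyer.Rank1Residual.X11b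

end
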